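import Literature.AnabelianGeometry.EtaleTheta.Conventions
import Literature.AnabelianGeometry.EtaleTheta.Setting

/-!
# Kernel DAG index — layer L2, part x (abc-iut-dag's MACHINE DELTA-DRAFT plan/kernel-draft/DAGL2u.lean @03:00Z, deduplicated against the tree by abc-iut-c312-2 and re-lettered; encoding as in c312-2's generated parts @2026-08-26T03:05Z from HOME/plan/DAG.tsv +
KERNEL-DAG-MODULES.tsv (regenerated 2026-08-26T02:58:29Z): 2 landed/discharged nodes NOT YET in the tree index Summits/ABC/IUTFork/DAG*.lean; spec v1.3 §2 (M))

THIS FILE PROVES NOTHING NEW AND ASSERTS NOTHING (HOME/plan/KERNEL-DAG-SPEC.md). It gives ONE NAME `N_<kernel_id>` to each DAG node whose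
statement has LANDED through the gate, knitting the landed declarations BY NAME: claim nodes `N_<id> : Prop := StatementOf @thm₁ ∧ …` (one
conjunct per landed theorem the DAG row names, universe levels instantiated explicitly per the spec's UNIVERSE RULE, arities read off the farm),
witnessed `N_<id>_holds` iff the DAG row is `discharged(p…)` and `N_<id>_part` otherwise (spec §2(b),(c); c312-2 F1/F2); data nodes
`abbrev N_<id> := @<primary>` with the row's further declarations as `example := @…` lines; FACT-style `def … : Prop` declarations are data
here (a NAME, never asserted). Decl lists come from the `decls` column of plan/DAG.tsv as resolved against the tree sources (unresolvable
tokens dropped and reported to abc-iut-dag on STATUS). Nothing here says abc is proved or refuted or takes a side on [IUTchIII] Cor 3.12.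
typed ≠ discharged; indexed ≠ endorsed.
-/

namespace Summit.ABC.IUTFork.DAG

namespace PartL2x
/-- `StatementOf h` is the statement (a `Prop`) of which the landed `h` is the proof: the index NAMES statements, it never re-types them. -/
abbrev StatementOf {P : Prop} (_h : P) : Prop := P
end PartL2x
open PartL2x

noncomputable section
universe u₁ u₂ u₃ u₄ u₅ u₆ u₇ u₈ u₉ u₁₀ u₁₁ u₁₂ u₁₃ u₁₄ u₁₅ u₁₆

/-- [node EtTh:§0 · L2/D1 · [EtTh] §0 Notations and Conventions, kurims p.5ff · p404034 · claim · DAG status discharged(p404034)] decls 31 · cites→ - -/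
def N_EtTh_S0 : Prop :=
  StatementOf @Literature.AnabelianGeometry.EtaleTheta.mem_groupSaturation_iff.{u₁} ∧
  StatementOf @Literature.AnabelianGeometry.EtaleTheta.le_groupSaturation.{u₁} ∧
  StatementOf @Literature.AnabelianGeometry.EtaleTheta.mem_groupSaturation_iff_grothendieckGroup.{u₁} ∧
  StatementOf @Literature.AnabelianGeometry.EtaleTheta.isGroupSaturated_iff'.{u₁} ∧
  StatementOf @Literature.AnabelianGeometry.EtaleTheta.mem_perfSaturation_iff.{u₁} ∧
  StatementOf @Literature.AnabelianGeometry.EtaleTheta.le_perfSaturation.{u₁} ∧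
  StatementOf @Literature.AnabelianGeometry.EtaleTheta.IsMinimalCofree.unique.{u₁} ∧
  StatementOf @Literature.AnabelianGeometry.EtaleTheta.IsCofree.map_continuousMulEquiv.{u₁} ∧
  StatementOf @Literature.AnabelianGeometry.EtaleTheta.IsMinimalCofree.map_eq_of_continuousMulEquiv.{u₁} ∧
  StatementOf @Literature.AnabelianGeometry.EtaleTheta.IsIsomorph.refl.{u₁, u₂} ∧
  StatementOf @Literature.AnabelianGeometry.EtaleTheta.IsIsomorph.symm.{u₁, u₂} ∧
  StatementOf @Literature.AnabelianGeometry.EtaleTheta.IsIsomorph.trans.{u₁, u₂}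
/-- discharge of `N_EtTh_S0`: the landed theorems it names, BY NAME (spec §2(c)); proves nothing new. -/
theorem N_EtTh_S0_holds : N_EtTh_S0 := ⟨@Literature.AnabelianGeometry.EtaleTheta.mem_groupSaturation_iff, @Literature.AnabelianGeometry.EtaleTheta.le_groupSaturation, @Literature.AnabelianGeometry.EtaleTheta.mem_groupSaturation_iff_grothendieckGroup, @Literature.AnabelianGeometry.EtaleTheta.isGroupSaturated_iff', @Literature.AnabelianGeometry.EtaleTheta.mem_perfSaturation_iff, @Literature.AnabelianGeometry.EtaleTheta.le_perfSaturation, @Literature.AnabelianGeometry.EtaleTheta.IsMinimalCofree.unique, @Literature.AnabelianGeometry.EtaleTheta.IsCofree.map_continuousMulEquiv, @Literature.AnabelianGeometry.EtaleTheta.IsMinimalCofree.map_eq_of_continuousMulEquiv, @Literature.AnabelianGeometry.EtaleTheta.IsIsomorph.refl, @Literature.AnabelianGeometry.EtaleTheta.IsIsomorph.symm, @Literature.AnabelianGeometry.EtaleTheta.IsIsomorph.trans⟩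
-- (+6 further theorems of this node not conjoined in the draft)
example := @Literature.AnabelianGeometry.EtaleTheta.groupSaturation.{u₁}
example := @Literature.AnabelianGeometry.EtaleTheta.IsGroupSaturated.{u₁}
example := @Literature.AnabelianGeometry.EtaleTheta.perfSaturation.{u₁}
example := @Literature.AnabelianGeometry.EtaleTheta.IsPerfSaturated.{u₁}
example := @Literature.AnabelianGeometry.EtaleTheta.IsCofree.{u₁}
example := @Literature.AnabelianGeometry.EtaleTheta.IsMinimalCofree.{u₁}

/-- [node EtTh:§1-Setting · L2/D1 · [EtTh] §1 pp.11–15 (un-numbered), p.10–13 · p404928 · data] decls 28 · cites→ - -/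
abbrev N_EtTh_S1_Setting := @Literature.AnabelianGeometry.EtaleTheta.fieldKN
example := @Literature.AnabelianGeometry.EtaleTheta.fieldJN
example := @Literature.AnabelianGeometry.EtaleTheta.fieldJddN
example := @Literature.AnabelianGeometry.EtaleTheta.IsFreeProfiniteOnTwo.{u₁}
example := @Literature.AnabelianGeometry.EtaleTheta.ThetaSetting
example := @Literature.AnabelianGeometry.EtaleTheta.ThetaSetting.Gtp
example := @Literature.AnabelianGeometry.EtaleTheta.ThetaSetting.Dtp
example := @Literature.AnabelianGeometry.EtaleTheta.ThetaSetting.GtpY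
example := @Literature.AnabelianGeometry.EtaleTheta.ThetaSetting.DtpY
example := @Literature.AnabelianGeometry.EtaleTheta.ThetaSetting.DtpYN
-- (+18 further declarations of this node)

end

end Summit.ABC.IUTFork.DAG
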